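import Literature.AnabelianGeometry.AbsoluteAnabelian.ArchimedeanLogFrobeniusProp42Sub
import Literature.AnabelianGeometry.AbsoluteAnabelian.ArchimedeanLogFrobeniusLinHolProofs
import Literature.AnabelianGeometry.AbsoluteAnabelian.ArchimedeanReconstructionCor29ModelProofs
import Literature.AnabelianGeometry.AbsoluteAnabelian.ArchimedeanUnivCover
import HarnessLib

/-!
# [AbsTopIII] Def 4.1 (i)(ii): the typed notions «model Aut-holomorphic `T`-pair» and
# «Aut-holomorphic `T`-pair» are INHABITED (kernel non-vacuity witness)

Mochizuki, *Topics in Absolute Anabelian Geometry III*, Definition 4.1 (i)(ii) pp. 101–102 of the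
author's kurims manuscript (lit key `paper:url-5493eb38cbb7`; bib key `MochizukiAbsTopIII2015`).
PROOF-ONLY file (abc-iut cell, seat abc-iut-w5-d210; nodes `AbsTopIII:Def4.1(i)`/`(ii)` — non-vacuity
of the DEFS-FREEZE file `ArchimedeanLogFrobenius.lean` p408080, and the object datum (M2) of
sub-DAG row C45-M0 of plan/L4/SUBDAG-AbsTopIII-Cor45.md).  Nothing is declared; the witnesses are
assembled INSIDE the proofs from parts already in the tree:

* the Riemann surface `ℂ` as an Aut-holomorphic orbispace with trivial group
  (`AutHolOrbiPresentation.ofSpace ℂ`, abc-iut-L4-t2, `Coorientations.lean`);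
* the local linear holomorphic structure of the plane (`ArchimedeanReconstruction.Cor29Model.planeStructure`:
  `𝒜_p =` germs of `z ↦ p + c (z − p)`, abc-iut-w5-d225) and the field `𝒜_𝕏 := ℂ` with the
  tautological isomorphisms `ℂ^× ⥲ 𝒜_p` (`germAutIsoUnits`, abc-iut-L4-t8/t14 lineage);
* the CAF `k := ℂ` (`isCAF_complex`) with the identity Kummer structure `κ_k := id : ℂ ⥲ 𝒜_𝕏`;
* `AutHolPair.Iso.refl` (abc-iut-w5-d226) for "isomorphic to a model pair".

Results: `nonempty_modelAutHolPair` (every ALGEBRAIC type `T ∈ {TF, TCG, TLG, TM}` has a model pair),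
`exists_isAutHolPair` (every algebraic `T` has an Aut-holomorphic `T`-pair), with the `TF` cases
singled out.  HONEST SCOPE: print's `𝕏` is an ELLIPTICALLY ADMISSIBLE Aut-holomorphic orbispace; the
typed `ModelAutHolPair` (policy θ of the L4 typing: the local linear holomorphic structure of
Cor. 2.7 (e) is SUPPLIED AS DATA, not reconstructed) carries no admissibility field, and the witness
here is `𝕏 = ℂ`, which is not elliptically admissible — so this certifies non-vacuity of the TYPED
predicates exactly as frozen, and records (for the L4 lanes) that admissibility is provenance, not a
constraint, in `ArchimedeanLogFrobenius.lean`.  Classical; nothing here bears on [IUTchIII] Cor. 3.12.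
-/

namespace Literature.AnabelianGeometry.AbsoluteAnabelian

open scoped Manifold ContDiff

noncomputable section

/-- The arithmetic data `M_k ⊆ k` of a model pair of ANY type is closed under multiplication
(`k`, `𝒪_k^×`, `k^×`, `𝒪_k^⊳`; empty for the non-algebraic types).
[cite: MochizukiAbsTopIII2015, Definition 4.1 (i) p.102] -/
theorem ModelAutHolPair.mul_mem_arithData {T : ArchPairType} (P : ModelAutHolPair T) (x y : P.k)
    (hx : x ∈ P.arithData) (hy : y ∈ P.arithData) : x * y ∈ P.arithData := by
  cases T with
  | TF => simp [ModelAutHolPair.arithData]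
  | TCG =>
    simp only [ModelAutHolPair.arithData, Set.mem_setOf_eq, norm_mul] at hx hy ⊢
    rw [hx, hy, one_mul]
  | TLG =>
    simp only [ModelAutHolPair.arithData, Set.mem_setOf_eq] at hx hy ⊢
    exact mul_ne_zero hx hy
  | TM =>
    simp only [ModelAutHolPair.arithData, Set.mem_setOf_eq, norm_mul] at hx hy ⊢
    exact ⟨mul_ne_zero hx.1 hy.1, mul_le_one₀ hx.2 (norm_nonneg _) hy.2⟩
  | TH => simp [ModelAutHolPair.arithData] at hx
  | THadd => simp [ModelAutHolPair.arithData] at hx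

/-- The arithmetic data of a model pair of ALGEBRAIC type contains `1`.
[cite: MochizukiAbsTopIII2015, Definition 4.1 (i) p.102] -/
theorem ModelAutHolPair.one_mem_arithData {T : ArchPairType} (P : ModelAutHolPair T)
    (hT : T.IsAlgebraic) : (1 : P.k) ∈ P.arithData := by
  cases T with
  | TF => simp [ModelAutHolPair.arithData]
  | TCG => simp [ModelAutHolPair.arithData]
  | TLG => simp [ModelAutHolPair.arithData]
  | TM => simp [ModelAutHolPair.arithData]
  | TH => exact absurd rfl hT.1
  | THadd => exact absurd rfl hT.2

/-- **Def 4.1 (i) is inhabited**: for every algebraic type `T` there is a model Aut-holomorphic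
`T`-pair — `k := ℂ`, `𝕏 := ℂ` (trivial group), `𝒜_p :=` the affine germs at `p`, `𝒜_𝕏 := ℂ`, `κ_k := id`.
[cite: MochizukiAbsTopIII2015, Definition 4.1 (i) p.102] -/
theorem nonempty_modelAutHolPair (T : ArchPairType) (hT : T.IsAlgebraic) :
    Nonempty (ModelAutHolPair.{0} T) := by
  let X : AutHolOrbiPresentation.{0} := AutHolOrbiPresentation.ofSpace ℂ
  let L : LocalLinearHolStructure X.U := ArchimedeanReconstruction.Cor29Model.planeStructure
  let A : LinHolField L :=
    { F := ℂ
      unitsIso := fun p => germAutIsoUnits p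
      unitsIso_trans := fun p p' => germAutIsoUnits_trans p p' }
  let κ : KummerStructure ℂ A :=
    { κ := RingEquiv.refl ℂ, continuous_κ := continuous_id, continuous_κ_symm := continuous_id }
  exact ⟨{ k := ℂ, isCAF := isCAF_complex, X := X, L := L, A := A, κ := κ, algebraic := hT }⟩

/-- The `TF` case: a model Aut-holomorphic `TF`-pair `(𝕏 ↶ k)` exists.
[cite: MochizukiAbsTopIII2015, Definition 4.1 (i) p.102] -/
theorem nonempty_modelAutHolPair_TF : Nonempty (ModelAutHolPair.{0} .TF) :=
  nonempty_modelAutHolPair .TF ⟨by decide, by decide⟩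

/-- Every model pair of algebraic type yields an Aut-holomorphic `T`-pair in the sense of Def. 4.1
(ii) (it is isomorphic to itself by `AutHolPair.Iso.refl`).
[cite: MochizukiAbsTopIII2015, Definition 4.1 (ii) p.102] -/
theorem ModelAutHolPair.isAutHolPair_toPair {T : ArchPairType} (Q : ModelAutHolPair T)
    (hT : T.IsAlgebraic) :
    IsAutHolPair T (Q.toPair (Q.mul_mem_arithData) (Q.one_mem_arithData hT)) :=
  ⟨⟨Q, Q.mul_mem_arithData, Q.one_mem_arithData hT, ⟨AutHolPair.Iso.refl _⟩⟩⟩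

/-- **Def 4.1 (ii) is inhabited**: for every algebraic type `T` there is an Aut-holomorphic
`T`-pair. [cite: MochizukiAbsTopIII2015, Definition 4.1 (ii) p.102] -/
theorem exists_isAutHolPair (T : ArchPairType) (hT : T.IsAlgebraic) :
    ∃ P : AutHolPair.{0}, IsAutHolPair T P := by
  obtain ⟨Q⟩ := nonempty_modelAutHolPair T hT
  exact ⟨_, Q.isAutHolPair_toPair hT⟩

/-- The `TF` case of Def. 4.1 (ii): an Aut-holomorphic `TF`-pair exists (the object datum (M2) «an
object of `𝒞^hol_TF` / `LinHol`» of the Cor. 4.5 model inputs, up to elliptic admissibility — see the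
module docstring). [cite: MochizukiAbsTopIII2015, Definition 4.1 (ii) p.102] -/
theorem exists_isAutHolPair_TF : ∃ P : AutHolPair.{0}, IsAutHolPair .TF P :=
  exists_isAutHolPair .TF ⟨by decide, by decide⟩

end

end Literature.AnabelianGeometry.AbsoluteAnabelian
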